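import Mathlib
import Summits.Ventures.PercRepro2.Defs
import Summits.Ventures.PercRepro2.Harris
import Summits.Ventures.PercRepro2.Graph
import Summits.Ventures.PercRepro2.Events
import Summits.Ventures.PercRepro2.Induced
import Summits.Ventures.PercRepro2.BHKEvents
import Summits.Ventures.PercRepro2.BHKMixed
import Summits.Ventures.PercRepro2.BHKMixedAnti

/-!
# (R2-1) from its `y`-cluster form (CD) (PercRepro2, p2)

The four-vertex inequality **(R2-1)** of the (PM⁺) line (P2-G18-BERN.md §7d.1, the hypothesis `hR`
of `psi_bern_t_of_r21_psi0`) — with `𝟙 = {s ↮ y}`, `a = {u ∈ C_s}`, `h = {o ∈ C_s}`, `ℓ = {o ↔ y}`,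

  `P(𝟙a)·P(h) + P(𝟙h)·P(a) + P(𝟙ℓ)·P(a) ≤ P(𝟙ah) + P(𝟙ℓa) + P(𝟙)·P(ah)`

— follows from the SAME inequality with the one mass `P(𝟙ah) = P(u ∈ C_s, o ∈ C_s, s ↮ y)` replaced
by the smaller **shared-cluster term** `z = E[g_o(C_y) · g_u(C_y) · 1_{s↮y}]`, where
`g_v(W) = P(v ∈ C_s in G ∖ W)` (`delClusterProb`): `z` is the probability that `o ∈ C_s` and `u ∈ C_s`
in two configurations that are conditionally independent given a common cluster of `y`
(P2-G19-YCLUSTER.md §0.2, §1.1).  This is the `y`-cluster form **(CD)**: conditioning on `C_y`,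
the inequality `Cov(f, a) ≥ 0` (`f = 𝟙(m − h̄) + r_y h`) decomposes into the covariance of the
conditional expectations plus a Harris term, and the Harris term is exactly `(1 + P(𝟙))·(P(𝟙ah) − z)`.

The proof is the tower identity `prob_clusterIn_inter_eq_expect` with the roots `(y, s)` —
`P(𝟙ah) = E[g_{o,u}(C_y) 1_{s↮y}]` with `g_{o,u}(W) = P(o, u ∈ C_s in G ∖ W)` — and Harris in
`G ∖ W` fibre by fibre (`g_{o,u}(W) ≥ g_o(W) g_u(W)`, `delClusterProb_mul_le_inter_ycl`).

* `isUpperSet_delCluster_ycl` — `{ω | C_s(G ∖ W, ω) ∈ 𝓥}` is an up-set for an up-set `𝓥`;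
* `delClusterProb_mul_le_inter_ycl` — Harris in `G ∖ W`: `g_𝓤(W) · g_𝓥(W) ≤ g_{𝓤∩𝓥}(W)`;
* `prob_avoid_inter_eq_expect_del_ycl` — the tower identity for `P(u ∈ C_s, o ∈ C_s, s ↮ y)`;
* `shared_le_prob_ycl` — `z ≤ P(𝟙ah)`;
* `r21_of_cd` — **(CD) ⟹ (R2-1)**.
-/

namespace Summit.Ventures.PercRepro2

section R21OfCD

variable {V : Type*} [Fintype V] [DecidableEq V] {E : Type*} [Fintype E] [DecidableEq E]
  {R : Type*} [CommRing R] [LinearOrder R] [IsStrictOrderedRing R]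

omit [Fintype V] [DecidableEq V] [Fintype E] [DecidableEq E] in
/-- `{ω | C_s(G ∖ W, ω) ∈ 𝓥}` is an up-set of configurations when `𝓥` is an up-set of vertex sets. -/
lemma isUpperSet_delCluster_ycl (ends : E → Sym2 V) (W : Set V) (s : V) {𝓥 : Set (Set V)}
    (h𝓥 : IsUpperSet 𝓥) :
    IsUpperSet {ω : Config E | cluster ends (delConfig ends W ω) s ∈ 𝓥} := by
  intro ω ω' h hω
  exact h𝓥 (cluster_mono (BHKMixed.delConfig_mono_config ends W h) s) hω

omit [Fintype V] [DecidableEq V] in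
/-- **Harris in `G ∖ W`**: for up-sets `𝓤, 𝓥`, `g_𝓤(W) · g_𝓥(W) ≤ g_{𝓤∩𝓥}(W)` with
`g_𝓔(W) = P(C_s ∈ 𝓔 in G ∖ W)` (`delClusterProb`). -/
lemma delClusterProb_mul_le_inter_ycl (p : E → R) (hp : IsProbVec p) (ends : E → Sym2 V) (s : V) (W : Set V)
    {𝓤 𝓥 : Set (Set V)} (h𝓤 : IsUpperSet 𝓤) (h𝓥 : IsUpperSet 𝓥) :
    delClusterProb p ends s 𝓤 W * delClusterProb p ends s 𝓥 W ≤
      delClusterProb p ends s (𝓤 ∩ 𝓥) W := by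
  unfold delClusterProb
  have h := prob_mul_prob_le_prob_inter hp (isUpperSet_delCluster_ycl ends W s h𝓤)
    (isUpperSet_delCluster_ycl ends W s h𝓥)
  convert h using 2
  ext ω
  simp only [Set.mem_setOf_eq, Set.mem_inter_iff]

omit [DecidableEq V] [LinearOrder R] [IsStrictOrderedRing R] in
/-- **Tower identity with the roots `(y, s)`**: `P(u ∈ C_s, o ∈ C_s, s ↮ y) = E[g_{o,u}(C_y) · 1_{s↮y}]`
with `g_{o,u}(W) = P(o ∈ C_s, u ∈ C_s in G ∖ W)`. -/
lemma prob_avoid_inter_eq_expect_del_ycl (p : E → R) (ends : E → Sym2 V) (s y o u : V) :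
    prob p (connEvent ends s u ∩ clusterInEvent ends s {W : Set V | o ∈ W} ∩
        (connEvent ends s y)ᶜ) =
      expect p (fun ω => delClusterProb p ends s ({W : Set V | o ∈ W} ∩ {W : Set V | u ∈ W})
        (cluster ends ω y) * ((connEvent ends y s)ᶜ).indicator 1 ω) := by
  have e := prob_clusterIn_inter_eq_expect p ends y s Set.univ
    ({W : Set V | o ∈ W} ∩ {W : Set V | u ∈ W})
  simp only [Set.indicator_univ, Pi.one_apply, one_mul] at e
  have hset : clusterInEvent ends y Set.univ ∩
      clusterInEvent ends s ({W : Set V | o ∈ W} ∩ {W : Set V | u ∈ W}) ∩ (connEvent ends y s)ᶜ =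
      connEvent ends s u ∩ clusterInEvent ends s {W : Set V | o ∈ W} ∩ (connEvent ends s y)ᶜ := by
    ext ω
    simp only [Set.mem_inter_iff, mem_clusterInEvent, Set.mem_univ, true_and, Set.mem_setOf_eq,
      Set.mem_compl_iff, mem_connEvent, mem_cluster]
    constructor
    · rintro ⟨⟨ho, hu⟩, hys⟩
      exact ⟨⟨hu, ho⟩, fun h => hys (conn_symm h)⟩
    · rintro ⟨⟨hu, ho⟩, hsy⟩
      exact ⟨⟨ho, hu⟩, fun h => hsy (conn_symm h)⟩
  rw [hset] at e
  exact e

omit [DecidableEq V] in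
/-- **The shared-cluster term is at most the joint mass**:
`E[g_o(C_y) g_u(C_y) 1_{s↮y}] ≤ P(u ∈ C_s, o ∈ C_s, s ↮ y)` — Harris in `G ∖ C_y`, fibre by fibre. -/
lemma shared_le_prob_ycl (p : E → R) (hp : IsProbVec p) (ends : E → Sym2 V) (s y o u : V) :
    expect p (fun ω => delClusterProb p ends s {W : Set V | o ∈ W} (cluster ends ω y) *
        delClusterProb p ends s {W : Set V | u ∈ W} (cluster ends ω y) *
        ((connEvent ends y s)ᶜ).indicator 1 ω) ≤
      prob p (connEvent ends s u ∩ clusterInEvent ends s {W : Set V | o ∈ W} ∩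
        (connEvent ends s y)ᶜ) := by
  rw [prob_avoid_inter_eq_expect_del_ycl p ends s y o u]
  refine expect_mono hp fun ω => ?_
  refine mul_le_mul_of_nonneg_right ?_ (Set.indicator_nonneg (fun _ _ => zero_le_one) ω)
  exact delClusterProb_mul_le_inter_ycl p hp ends s (cluster ends ω y)
    (fun W W' h hW => h hW) (fun W W' h hW => h hW)

omit [DecidableEq V] in
/-- **(R2-1) from its `y`-cluster form (CD).**  If the (R2-1) inequality holds with the joint mass
`P(u ∈ C_s, o ∈ C_s, s ↮ y)` replaced by the shared-cluster term
`z = E[g_o(C_y) g_u(C_y) 1_{s↮y}]` — the hypothesis `hCD`, in the multiplied-out form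
`P(𝟙a)·P(h) + P(𝟙h)·P(a) + P(𝟙ℓ)·P(a) ≤ (1 + P(𝟙))·z + P(𝟙ℓa) + P(𝟙)·P(ah, s ↔ y)` — then (R2-1)
holds: `P(𝟙a)·P(h) + P(𝟙h)·P(a) + P(𝟙ℓ)·P(a) ≤ P(𝟙ah) + P(𝟙ℓa) + P(𝟙)·P(ah)`. -/
theorem r21_of_cd (p : E → R) (hp : IsProbVec p) (ends : E → Sym2 V) (s y o u : V)
    (hCD : prob p (connEvent ends s u ∩ (connEvent ends s y)ᶜ) *
        prob p (clusterInEvent ends s {W : Set V | o ∈ W}) +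
      prob p (clusterInEvent ends s {W : Set V | o ∈ W} ∩ (connEvent ends s y)ᶜ) *
        prob p (connEvent ends s u) +
      prob p (connEvent ends y o ∩ (connEvent ends s y)ᶜ) * prob p (connEvent ends s u) ≤
      (1 + prob p (connEvent ends s y)ᶜ) *
        expect p (fun ω => delClusterProb p ends s {W : Set V | o ∈ W} (cluster ends ω y) *
          delClusterProb p ends s {W : Set V | u ∈ W} (cluster ends ω y) *
          ((connEvent ends y s)ᶜ).indicator 1 ω) +
      prob p (connEvent ends s u ∩ connEvent ends y o ∩ (connEvent ends s y)ᶜ) +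
      prob p (connEvent ends s y)ᶜ *
        prob p (connEvent ends s u ∩ clusterInEvent ends s {W : Set V | o ∈ W} ∩
          connEvent ends s y)) :
    prob p (connEvent ends s u ∩ (connEvent ends s y)ᶜ) *
        prob p (clusterInEvent ends s {W : Set V | o ∈ W}) +
      prob p (clusterInEvent ends s {W : Set V | o ∈ W} ∩ (connEvent ends s y)ᶜ) *
        prob p (connEvent ends s u) +
      prob p (connEvent ends y o ∩ (connEvent ends s y)ᶜ) * prob p (connEvent ends s u) ≤
      prob p (connEvent ends s u ∩ clusterInEvent ends s {W : Set V | o ∈ W} ∩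
        (connEvent ends s y)ᶜ) +
      prob p (connEvent ends s u ∩ connEvent ends y o ∩ (connEvent ends s y)ᶜ) +
      prob p (connEvent ends s y)ᶜ *
        prob p (connEvent ends s u ∩ clusterInEvent ends s {W : Set V | o ∈ W}) := by
  have hz := shared_le_prob_ycl p hp ends s y o u
  have hsplit := prob_inter_add_prob_inter_compl p
    (connEvent ends s u ∩ clusterInEvent ends s {W : Set V | o ∈ W}) (connEvent ends s y)
  have hr : 0 ≤ prob p (connEvent ends s y)ᶜ := prob_nonneg hp _
  have hmul := mul_le_mul_of_nonneg_left hz (by linarith : (0 : R) ≤ 1 + prob p (connEvent ends s y)ᶜ)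
  nlinarith [hmul, hsplit, hCD, hr]

end R21OfCD

end Summit.Ventures.PercRepro2
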